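import Literature.Probability.LatticeModels.DobrushinMetricInfiniteRange
import HarnessLib

/-!
# Föllmer's comparison theorem WITH DEFECTS for infinite-range one-site laws with summable rows
(abstract layer)

[topic Probability/LatticeModels]

`DobrushinMetricInfiniteRange.lean` proves Dobrushin's comparison estimate in the Vasserstein form for
TWO INVARIANT states of the same one-site operators with SUMMABLE rows (`est_update_tsum`,
`est_phi_tsum`, `est_iterate_phi_tsum`, `abs_sub_le_tsum_weighted`): Föllmer 1988, Ch. I, Lemma (2.5)
and the Comparison Theorem (2.8) with defect `b ≡ 0`. `DobrushinComparisonDefect.lean` proves the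
theorem WITH DEFECTS — the second functional is an arbitrary state whose defect at the site `x` is
`|E₂ (T x f) - E₂ f| ≤ b x · δ_x(f)` — but only for FINITE neighbour sets. This file is the missing
corner: **defects AND summable (infinite-range) rows**, in the abstract layer of
`DobrushinMetricInfiniteRange` (summable Lipschitz vectors, `∑'`-rows):

* `est_update_tsum_defect`, `est_update_min_tsum_defect` — the dusting step `a ↦ (C a)_x + b_x` at `x`
  (Föllmer 1988, Ch. I, proof of Lemma (2.5) with the extra term of (2.8): "`a ↦ aC + b`");
* `est_phiDefect_tsum` — Föllmer's finite sweeps `a^J = min(a, Φ_b a)` on `J` plus the tail estimate;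
* `iterate_phiDefect_tsum_le` — all sites usable, rows `≤ c ≤ 1`, a bounded super-solution `d ≥ 0` of
  `b + C d ≤ d`: `0 ≤ Φ_bⁿ R ≤ R cⁿ + d`;
* `est_iterate_phiDefect_tsum`, ★ `abs_sub_le_tsum_of_superSolution` — for an invariant state `E₁`
  and a state `E₂` with defect `b`, rows `≤ c < 1`: `|E₁ F - E₂ F| ≤ ∑' y, d y · δ y` (Föllmer 1988,
  Ch. I, Comparison Theorem (2.8) with (2.10): `|μ f - μ̃ f| ≤ ∑_y (δ(f) D)_y b_y`, `D = ∑ₙ Cⁿ`, here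
  through any super-solution `d ≥ D b`).

Pure bookkeeping (no measure theory); the measure-level instantiation (Gibbs measure of `γ` versus
a Gibbs measure of another specification `γ'`, site-dependent kernel defect) is the companion file
`DobrushinMetricInfiniteRangeDefectStates.lean`.

## References
* H. Föllmer, *Random fields and diffusion processes*, LNM 1362 (1988), Ch. I, Lemma (2.5),
  Comparison Theorem (2.8), (2.10), Remark (2.17).
* H.-O. Georgii, *Gibbs Measures and Phase Transitions*, 2nd ed. (2011), Thm. 8.20, Remark 8.26.
* R. L. Dobrushin, Theory Probab. Appl. 15 (1970) 458–486, Thm. 3.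
-/

noncomputable section

open Finset Function Filter
open scoped Topology

namespace Literature.Probability.LatticeModels

namespace DobrushinMetric

section Abstract

variable {ι Ω : Type*} [DecidableEq ι]
variable {R B : ℝ} {Adm : (Ω → ℝ) → Prop} {Lip : (Ω → ℝ) → (ι → ℝ) → Prop}
  {T : ι → (Ω → ℝ) → (Ω → ℝ)} {C : ι → ι → ℝ} {W : Set ι} {E₁ E₂ : (Ω → ℝ) → ℝ} {b : ι → ℝ}

omit [DecidableEq ι] in
/-- A nonnegative vector bounded by `B`, multiplied by a nonnegative summable vector, is summable.
[folklore] -/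
private theorem summable_mul_of_bdd' {a δ : ι → ℝ} (ha0 : ∀ y, 0 ≤ a y) (haB : ∀ y, a y ≤ B)
    (hδ0 : ∀ y, 0 ≤ δ y) (hδs : Summable δ) : Summable fun y => a y * δ y :=
  Summable.of_nonneg_of_le (fun y => mul_nonneg (ha0 y) (hδ0 y))
    (fun y => mul_le_mul_of_nonneg_right (haB y) (hδ0 y)) (hδs.mul_left B)

omit [DecidableEq ι] in
/-- A nonnegative summable row, multiplied by a nonnegative vector bounded by `B`, is summable.
[folklore] -/
private theorem summable_row_mul_of_bdd' {c a : ι → ℝ} (hc0 : ∀ y, 0 ≤ c y) (hcs : Summable c)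
    (ha0 : ∀ y, 0 ≤ a y) (haB : ∀ y, a y ≤ B) : Summable fun y => c y * a y :=
  Summable.of_nonneg_of_le (fun y => mul_nonneg (hc0 y) (ha0 y))
    (fun y => mul_le_mul_of_nonneg_left (haB y) (hc0 y)) (hcs.mul_right B)

/-- **Dusting step with defect, summable rows** (Föllmer 1988, Ch. I, proof of Lemma (2.5) with the
extra term of the Comparison Theorem (2.8): `a ↦ aC + b`): if the bounded nonnegative vector `a` is
an estimate for the invariant state `E₁` against the state `E₂` whose defect at the usable site `x`
is `|E₂ (T x F) - E₂ F| ≤ b x · δ x`, then replacing `a x` by `∑' z, C x z · a z + b x` gives an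
estimate. [cite: Follmer1988, Ch. I Comparison Theorem (2.8)] -/
theorem est_update_tsum_defect (hlip0 : ∀ ⦃F : Ω → ℝ⦄ ⦃δ : ι → ℝ⦄, Lip F δ → ∀ y, 0 ≤ δ y)
    (hlips : ∀ ⦃F : Ω → ℝ⦄ ⦃δ : ι → ℝ⦄, Lip F δ → Summable δ)
    (hC0 : ∀ x y, 0 ≤ C x y) (hCs : ∀ x, Summable (C x))
    (hT : ∀ ⦃F : Ω → ℝ⦄ (x : ι), Adm F → Adm (T x F))
    (hdust : ∀ ⦃F : Ω → ℝ⦄ ⦃δ : ι → ℝ⦄ (x : ι), Adm F → Lip F δ →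
      Lip (T x F) fun y => if y = x then 0 else δ y + C x y * δ x)
    (h₁T : ∀ ⦃F : Ω → ℝ⦄ (x : ι), x ∈ W → Adm F → E₁ (T x F) = E₁ F)
    (h₂D : ∀ ⦃F : Ω → ℝ⦄ ⦃δ : ι → ℝ⦄ (x : ι), x ∈ W → Adm F → Lip F δ →
      |E₂ (T x F) - E₂ F| ≤ b x * δ x)
    {a : ι → ℝ} (ha : ∀ ⦃F : Ω → ℝ⦄ ⦃δ : ι → ℝ⦄, Adm F → Lip F δ → |E₁ F - E₂ F| ≤ ∑' y, a y * δ y)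
    (ha0 : ∀ y, 0 ≤ a y) (haB : ∀ y, a y ≤ B) (hb0 : ∀ y, 0 ≤ b y) {x : ι} (hx : x ∈ W)
    ⦃F : Ω → ℝ⦄ ⦃δ : ι → ℝ⦄ (hF : Adm F) (hδ : Lip F δ) :
    |E₁ F - E₂ F| ≤ ∑' y, Function.update a x (∑' z, C x z * a z + b x) y * δ y := by
  have hδ0 := hlip0 hδ
  have hδs := hlips hδ
  have hδ' := hdust x hF hδ
  have key := ha (hT x hF) hδ'
  -- the defect of `E₂` at `x`
  have hE : |E₁ F - E₂ F| ≤ |E₁ (T x F) - E₂ (T x F)| + b x * δ x := by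
    rw [← h₁T x hx hF]
    have h2 := h₂D x hx hF hδ
    calc |E₁ (T x F) - E₂ F| = |(E₁ (T x F) - E₂ (T x F)) + (E₂ (T x F) - E₂ F)| := by ring_nf
      _ ≤ |E₁ (T x F) - E₂ (T x F)| + |E₂ (T x F) - E₂ F| := abs_add_le _ _
      _ ≤ |E₁ (T x F) - E₂ (T x F)| + b x * δ x := by linarith
  refine hE.trans ?_
  -- summability bookkeeping
  set v : ℝ := ∑' z, C x z * a z with hv
  have hs1 : Summable fun y => a y * δ y := summable_mul_of_bdd' ha0 haB hδ0 hδs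
  have hs2 : Summable fun y => C x y * a y := summable_row_mul_of_bdd' (hC0 x) (hCs x) ha0 haB
  have hv0 : 0 ≤ v := tsum_nonneg fun z => mul_nonneg (hC0 x z) (ha0 z)
  have hs3 : Summable fun y => if y = x then (0 : ℝ) else a y * δ y :=
    Summable.of_nonneg_of_le
      (fun y => by split_ifs; exacts [le_rfl, mul_nonneg (ha0 y) (hδ0 y)])
      (fun y => by split_ifs; exacts [mul_nonneg (ha0 y) (hδ0 y), le_rfl]) hs1
  have hs4 : Summable fun y => if y = x then (0 : ℝ) else C x y * a y :=
    Summable.of_nonneg_of_le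
      (fun y => by split_ifs; exacts [le_rfl, mul_nonneg (hC0 x y) (ha0 y)])
      (fun y => by split_ifs; exacts [mul_nonneg (hC0 x y) (ha0 y), le_rfl]) hs2
  set v' : ℝ := v + b x with hv'
  have hv'0 : 0 ≤ v' := add_nonneg hv0 (hb0 x)
  have hu0 : ∀ y, 0 ≤ Function.update a x v' y := fun y => by
    rcases eq_or_ne y x with rfl | hne
    · rw [Function.update_self]; exact hv'0
    · rw [Function.update_of_ne hne]; exact ha0 y
  have huB : ∀ y, Function.update a x v' y ≤ max B v' := fun y => by
    rcases eq_or_ne y x with rfl | hne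
    · rw [Function.update_self]; exact le_max_right _ _
    · rw [Function.update_of_ne hne]; exact (haB y).trans (le_max_left _ _)
  have hs5 : Summable fun y => Function.update a x v' y * δ y := summable_mul_of_bdd' hu0 huB hδ0 hδs
  -- termwise splitting of the dusted estimate
  have hsplit : ∀ y, a y * (if y = x then 0 else δ y + C x y * δ x) =
      (if y = x then 0 else a y * δ y) + δ x * (if y = x then 0 else C x y * a y) := fun y => by
    split_ifs <;> ring
  have hite : ∑' y, (if y = x then (0 : ℝ) else C x y * a y) ≤ v :=
    hs4.tsum_le_tsum (fun y => by split_ifs; exacts [mul_nonneg (hC0 x y) (ha0 y), le_rfl]) hs2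
  have hupd : ∑' y, Function.update a x v' y * δ y =
      (∑' y, if y = x then (0 : ℝ) else a y * δ y) + v' * δ x := by
    rw [hs5.tsum_eq_add_tsum_ite x, Function.update_self, add_comm]
    congr 1
    refine tsum_congr fun y => ?_
    rcases eq_or_ne y x with rfl | hne
    · simp
    · rw [if_neg hne, if_neg hne, Function.update_of_ne hne]
  have hkey' : |E₁ (T x F) - E₂ (T x F)| ≤
      (∑' y, if y = x then (0 : ℝ) else a y * δ y) + δ x * v := by
    refine key.trans ?_
    calc ∑' y, a y * (if y = x then 0 else δ y + C x y * δ x)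
        = ∑' y, ((if y = x then 0 else a y * δ y) + δ x * (if y = x then 0 else C x y * a y)) :=
          tsum_congr hsplit
      _ = (∑' y, if y = x then (0 : ℝ) else a y * δ y) +
            δ x * ∑' y, (if y = x then (0 : ℝ) else C x y * a y) := by
          rw [hs3.tsum_add (hs4.mul_left (δ x)), tsum_mul_left]
      _ ≤ (∑' y, if y = x then (0 : ℝ) else a y * δ y) + δ x * v := by
          have := mul_le_mul_of_nonneg_left hite (hδ0 x)
          linarith
  rw [hupd, hv']
  nlinarith [hkey', hδ0 x]

/-- Dusting step with defect, monotone form: replacing `a x` by `min (a x) (∑' z, C x z · a z + b x)`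
gives an estimate (Föllmer's `a^J = min(a, aC + b)`). [cite: Follmer1988, Ch. I Lemma (2.5)] -/
theorem est_update_min_tsum_defect (hlip0 : ∀ ⦃F : Ω → ℝ⦄ ⦃δ : ι → ℝ⦄, Lip F δ → ∀ y, 0 ≤ δ y)
    (hlips : ∀ ⦃F : Ω → ℝ⦄ ⦃δ : ι → ℝ⦄, Lip F δ → Summable δ)
    (hC0 : ∀ x y, 0 ≤ C x y) (hCs : ∀ x, Summable (C x))
    (hT : ∀ ⦃F : Ω → ℝ⦄ (x : ι), Adm F → Adm (T x F))
    (hdust : ∀ ⦃F : Ω → ℝ⦄ ⦃δ : ι → ℝ⦄ (x : ι), Adm F → Lip F δ →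
      Lip (T x F) fun y => if y = x then 0 else δ y + C x y * δ x)
    (h₁T : ∀ ⦃F : Ω → ℝ⦄ (x : ι), x ∈ W → Adm F → E₁ (T x F) = E₁ F)
    (h₂D : ∀ ⦃F : Ω → ℝ⦄ ⦃δ : ι → ℝ⦄ (x : ι), x ∈ W → Adm F → Lip F δ →
      |E₂ (T x F) - E₂ F| ≤ b x * δ x)
    {a : ι → ℝ} (ha : ∀ ⦃F : Ω → ℝ⦄ ⦃δ : ι → ℝ⦄, Adm F → Lip F δ → |E₁ F - E₂ F| ≤ ∑' y, a y * δ y)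
    (ha0 : ∀ y, 0 ≤ a y) (haB : ∀ y, a y ≤ B) (hb0 : ∀ y, 0 ≤ b y) {x : ι} (hx : x ∈ W)
    ⦃F : Ω → ℝ⦄ ⦃δ : ι → ℝ⦄ (hF : Adm F) (hδ : Lip F δ) :
    |E₁ F - E₂ F| ≤ ∑' y, Function.update a x (min (a x) (∑' z, C x z * a z + b x)) y * δ y := by
  rcases le_total (a x) (∑' z, C x z * a z + b x) with h | h
  · rw [min_eq_left h, Function.update_eq_self]
    exact ha hF hδ
  · rw [min_eq_right h]
    exact est_update_tsum_defect hlip0 hlips hC0 hCs hT hdust h₁T h₂D ha ha0 haB hb0 hx hF hδ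

/-- The tail `∑'_{y ∉ s} δ y` of a nonnegative summable vector tends to `0` along the finite sets
`s`. [folklore] -/
private theorem tendsto_tsum_ite_compl' {δ : ι → ℝ} (hδ0 : ∀ y, 0 ≤ δ y) (hδs : Summable δ) :
    Tendsto (fun s : Finset ι => ∑' y, if y ∈ s then (0 : ℝ) else δ y) atTop (𝓝 0) := by
  classical
  have hdecomp : ∀ s : Finset ι,
      (∑' y, if y ∈ s then (0 : ℝ) else δ y) = (∑' y, δ y) - ∑ y ∈ s, δ y := fun s => by
    have hs_in : Summable fun y => if y ∈ s then δ y else (0 : ℝ) :=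
      Summable.of_nonneg_of_le (fun y => by split_ifs; exacts [hδ0 y, le_rfl])
        (fun y => by split_ifs; exacts [le_rfl, hδ0 y]) hδs
    have hs_out : Summable fun y => if y ∈ s then (0 : ℝ) else δ y :=
      Summable.of_nonneg_of_le (fun y => by split_ifs; exacts [le_rfl, hδ0 y])
        (fun y => by split_ifs; exacts [hδ0 y, le_rfl]) hδs
    have hsum : (∑' y, δ y) = (∑' y, if y ∈ s then δ y else (0 : ℝ)) +
        ∑' y, if y ∈ s then (0 : ℝ) else δ y := by
      rw [← hs_in.tsum_add hs_out]
      exact tsum_congr fun y => by split_ifs <;> simp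
    have hfin : (∑' y, if y ∈ s then δ y else (0 : ℝ)) = ∑ y ∈ s, δ y := by
      rw [tsum_eq_sum (s := s) (fun y hy => if_neg hy)]
      exact Finset.sum_congr rfl fun y hy => if_pos hy
    rw [hsum, hfin]
    ring
  simp_rw [hdecomp]
  have hlim : Tendsto (fun s : Finset ι => ∑ y ∈ s, δ y) atTop (𝓝 (∑' y, δ y)) := by
    have h := hδs.hasSum
    rwa [HasSum, SummationFilter.unconditional_filter] at h
  have := (tendsto_const_nhds (x := ∑' y, δ y)).sub hlim
  simpa using this

/-- **Lemma (2.5) of Föllmer with defect, vector form with summable rows**: if the bounded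
nonnegative vector `a` is an estimate, then so is its simultaneous update
`Φ_b a = (∑' z, C · z a z) + b` on the usable sites (`a` elsewhere), provided `Φ_b a` is bounded —
by the finite sweeps `a^J = min(a, Φ_b a)` on `J` and the tail estimate.
[cite: Follmer1988, Ch. I Lemma (2.5)] -/
theorem est_phiDefect_tsum [DecidablePred (· ∈ W)]
    (hlip0 : ∀ ⦃F : Ω → ℝ⦄ ⦃δ : ι → ℝ⦄, Lip F δ → ∀ y, 0 ≤ δ y)
    (hlips : ∀ ⦃F : Ω → ℝ⦄ ⦃δ : ι → ℝ⦄, Lip F δ → Summable δ)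
    (hC0 : ∀ x y, 0 ≤ C x y) (hCs : ∀ x, Summable (C x))
    (hT : ∀ ⦃F : Ω → ℝ⦄ (x : ι), Adm F → Adm (T x F))
    (hdust : ∀ ⦃F : Ω → ℝ⦄ ⦃δ : ι → ℝ⦄ (x : ι), Adm F → Lip F δ →
      Lip (T x F) fun y => if y = x then 0 else δ y + C x y * δ x)
    (h₁T : ∀ ⦃F : Ω → ℝ⦄ (x : ι), x ∈ W → Adm F → E₁ (T x F) = E₁ F)
    (h₂D : ∀ ⦃F : Ω → ℝ⦄ ⦃δ : ι → ℝ⦄ (x : ι), x ∈ W → Adm F → Lip F δ →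
      |E₂ (T x F) - E₂ F| ≤ b x * δ x)
    (hb0 : ∀ y, 0 ≤ b y)
    {phi : (ι → ℝ) → ι → ℝ} (hphi : ∀ a y, phi a y = if y ∈ W then ∑' z, C y z * a z + b y else a y)
    {a : ι → ℝ} (ha : ∀ ⦃F : Ω → ℝ⦄ ⦃δ : ι → ℝ⦄, Adm F → Lip F δ → |E₁ F - E₂ F| ≤ ∑' y, a y * δ y)
    (ha0 : ∀ y, 0 ≤ a y) (haB : ∀ y, a y ≤ B) (hphiB : ∀ y, phi a y ≤ B)
    ⦃F : Ω → ℝ⦄ ⦃δ : ι → ℝ⦄ (hF : Adm F) (hδ : Lip F δ) :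
    |E₁ F - E₂ F| ≤ ∑' y, phi a y * δ y := by
  have hδ0 := hlip0 hδ
  have hδs := hlips hδ
  have hphi0 : ∀ y, 0 ≤ phi a y := fun y => by
    rw [hphi]
    split_ifs
    · exact add_nonneg (tsum_nonneg fun z => mul_nonneg (hC0 y z) (ha0 z)) (hb0 y)
    · exact ha0 y
  -- finite sweeps
  have sweep : ∀ s : Finset ι, ∃ b' : ι → ℝ,
      (∀ ⦃F : Ω → ℝ⦄ ⦃δ : ι → ℝ⦄, Adm F → Lip F δ → |E₁ F - E₂ F| ≤ ∑' y, b' y * δ y) ∧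
      (∀ y, 0 ≤ b' y) ∧ (∀ y, b' y ≤ a y) ∧ ∀ y ∈ s, y ∈ W → b' y ≤ ∑' z, C y z * a z + b y := by
    intro s
    induction s using Finset.induction_on with
    | empty => exact ⟨a, ha, ha0, fun _ => le_rfl, fun _ h => (Finset.notMem_empty _ h).elim⟩
    | insert x s _ ih =>
      obtain ⟨b', hb', hb'0, hb'a, hb's⟩ := ih
      by_cases hx : x ∈ W
      · have hb'B : ∀ y, b' y ≤ B := fun y => (hb'a y).trans (haB y)
        refine ⟨Function.update b' x (min (b' x) (∑' z, C x z * b' z + b x)),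
          est_update_min_tsum_defect hlip0 hlips hC0 hCs hT hdust h₁T h₂D hb' hb'0 hb'B hb0 hx,
          fun y => ?_, fun y => ?_, fun y hy hyW => ?_⟩
        · rcases eq_or_ne y x with rfl | hne
          · rw [Function.update_self]
            exact le_min (hb'0 _)
              (add_nonneg (tsum_nonneg fun z => mul_nonneg (hC0 y z) (hb'0 z)) (hb0 y))
          · rw [Function.update_of_ne hne]; exact hb'0 y
        · rcases eq_or_ne y x with rfl | hne
          · rw [Function.update_self]; exact (min_le_left _ _).trans (hb'a _)
          · rw [Function.update_of_ne hne]; exact hb'a y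
        · rcases eq_or_ne y x with rfl | hne
          · rw [Function.update_self]
            refine (min_le_right _ _).trans (add_le_add ?_ le_rfl)
            exact (summable_row_mul_of_bdd' (hC0 y) (hCs y) hb'0 hb'B).tsum_le_tsum
              (fun z => mul_le_mul_of_nonneg_left (hb'a z) (hC0 y z))
              (summable_row_mul_of_bdd' (hC0 y) (hCs y) ha0 haB)
          · rw [Function.update_of_ne hne]
            exact hb's y ((Finset.mem_insert.1 hy).resolve_left hne) hyW
      · refine ⟨b', hb', hb'0, hb'a, fun y hy hyW => ?_⟩
        rcases eq_or_ne y x with rfl | hne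
        · exact (hx hyW).elim
        · exact hb's y ((Finset.mem_insert.1 hy).resolve_left hne) hyW
  -- the estimate of every sweep, bounded by `Φ_b a` plus a tail
  have hs_phi : Summable fun y => phi a y * δ y := summable_mul_of_bdd' hphi0 hphiB hδ0 hδs
  have htail : ∀ s : Finset ι, |E₁ F - E₂ F| ≤
      (∑' y, phi a y * δ y) + B * ∑' y, (if y ∈ s then (0 : ℝ) else δ y) := fun s => by
    obtain ⟨b', hb', hb'0, hb'a, hb's⟩ := sweep s
    have hs_b : Summable fun y => b' y * δ y :=
      summable_mul_of_bdd' hb'0 (fun y => (hb'a y).trans (haB y)) hδ0 hδs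
    have hs_t : Summable fun y => if y ∈ s then (0 : ℝ) else δ y :=
      Summable.of_nonneg_of_le (fun y => by split_ifs; exacts [le_rfl, hδ0 y])
        (fun y => by split_ifs; exacts [hδ0 y, le_rfl]) hδs
    refine (hb' hF hδ).trans ?_
    rw [← tsum_mul_left, ← hs_phi.tsum_add (hs_t.mul_left B)]
    refine hs_b.tsum_le_tsum (fun y => ?_) (hs_phi.add (hs_t.mul_left B))
    by_cases hys : y ∈ s
    · rw [if_pos hys, mul_zero, add_zero]
      refine mul_le_mul_of_nonneg_right ?_ (hδ0 y)
      by_cases hyW : y ∈ W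
      · rw [hphi, if_pos hyW]; exact hb's y hys hyW
      · rw [hphi, if_neg hyW]; exact hb'a y
    · rw [if_neg hys]
      have h1 : b' y * δ y ≤ B * δ y :=
        mul_le_mul_of_nonneg_right ((hb'a y).trans (haB y)) (hδ0 y)
      have h2 : 0 ≤ phi a y * δ y := mul_nonneg (hphi0 y) (hδ0 y)
      linarith
  have hlim : Tendsto (fun s : Finset ι =>
      (∑' y, phi a y * δ y) + B * ∑' y, (if y ∈ s then (0 : ℝ) else δ y)) atTop
      (𝓝 ((∑' y, phi a y * δ y) + B * 0)) :=
    ((tendsto_tsum_ite_compl' hδ0 hδs).const_mul B).const_add _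
  have h := ge_of_tendsto' hlim htail
  simpa using h

omit [DecidableEq ι] in
/-- **Iterates under a bounded super-solution** (Föllmer 1988, Ch. I, (2.10): `R Cⁿ + ∑_{k<n} b Cᵏ ≤
R cⁿ + D b`): all sites usable, rows `≤ c ≤ 1`, `0 ≤ d ≤ D` with `b y + ∑' z, C y z d z ≤ d y`; then
`0 ≤ Φ_bⁿ R ≤ R cⁿ + d`. [cite: Follmer1988, Ch. I (2.10)] -/
theorem iterate_phiDefect_tsum_le {D : ℝ} (hR : 0 ≤ R) (hC0 : ∀ x y, 0 ≤ C x y)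
    (hCs : ∀ x, Summable (C x)) (hb0 : ∀ y, 0 ≤ b y)
    {phi : (ι → ℝ) → ι → ℝ} (hphi : ∀ a y, phi a y = ∑' z, C y z * a z + b y)
    {c : ℝ} (hc0 : 0 ≤ c) (hc1 : c ≤ 1) (hrow : ∀ y, ∑' z, C y z ≤ c)
    {d : ι → ℝ} (hd0 : ∀ y, 0 ≤ d y) (hdD : ∀ y, d y ≤ D)
    (hsuper : ∀ y, b y + ∑' z, C y z * d z ≤ d y) (n : ℕ) (y : ι) :
    0 ≤ phi^[n] (fun _ => R) y ∧ phi^[n] (fun _ => R) y ≤ R * c ^ n + d y := by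
  induction n generalizing y with
  | zero => exact ⟨hR, by simp only [Function.iterate_zero, id_eq, pow_zero, mul_one]; linarith [hd0 y]⟩
  | succ n ih =>
    rw [Function.iterate_succ_apply', hphi]
    have hbdd : ∀ z, phi^[n] (fun _ => R) z ≤ R + D := fun z =>
      (ih z).2.trans (add_le_add (mul_le_of_le_one_right hR (pow_le_one₀ hc0 hc1)) (hdD z))
    have hs : Summable fun z => C y z * phi^[n] (fun _ => R) z :=
      summable_row_mul_of_bdd' (hC0 y) (hCs y) (fun z => (ih z).1) hbdd
    have hsd : Summable fun z => C y z * d z := summable_row_mul_of_bdd' (hC0 y) (hCs y) hd0 hdD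
    have hs2 : Summable fun z => C y z * (R * c ^ n + d z) := by
      have : (fun z => C y z * (R * c ^ n + d z)) = fun z => R * c ^ n * C y z + C y z * d z :=
        funext fun z => by ring
      rw [this]
      exact ((hCs y).mul_left (R * c ^ n)).add hsd
    refine ⟨add_nonneg (tsum_nonneg fun z => mul_nonneg (hC0 y z) (ih z).1) (hb0 y), ?_⟩
    calc (∑' z, C y z * phi^[n] (fun _ => R) z) + b y
        ≤ (∑' z, C y z * (R * c ^ n + d z)) + b y :=
          add_le_add (hs.tsum_le_tsum
            (fun z => mul_le_mul_of_nonneg_left (ih z).2 (hC0 y z)) hs2) le_rfl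
      _ = R * c ^ n * (∑' z, C y z) + ((∑' z, C y z * d z) + b y) := by
          rw [show (fun z => C y z * (R * c ^ n + d z)) = fun z => R * c ^ n * C y z + C y z * d z from
            funext fun z => by ring, ((hCs y).mul_left (R * c ^ n)).tsum_add hsd, tsum_mul_left]
          ring
      _ ≤ R * c ^ n * c + d y := by
          have h1 := mul_le_mul_of_nonneg_left (hrow y) (mul_nonneg hR (pow_nonneg hc0 n))
          linarith [hsuper y]
      _ = R * c ^ (n + 1) + d y := by rw [pow_succ]; ring

/-- **All iterates `Φ_bⁿ R` are estimates** (Föllmer 1988, Ch. I, proof of the Comparison Theorem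
(2.8): "applying the lemma successively"), for an invariant state `E₁`, a state `E₂` with defect `b`,
all sites usable, summable rows `≤ c ≤ 1` and a bounded super-solution `d`.
[cite: Follmer1988, Ch. I Comparison Theorem (2.8)] -/
theorem est_iterate_phiDefect_tsum {D : ℝ} (hR : 0 ≤ R)
    (hlip0 : ∀ ⦃F : Ω → ℝ⦄ ⦃δ : ι → ℝ⦄, Lip F δ → ∀ y, 0 ≤ δ y)
    (hlips : ∀ ⦃F : Ω → ℝ⦄ ⦃δ : ι → ℝ⦄, Lip F δ → Summable δ)
    (hosc : ∀ ⦃F : Ω → ℝ⦄ ⦃δ : ι → ℝ⦄, Adm F → Lip F δ → ∀ σ τ, |F σ - F τ| ≤ R * ∑' y, δ y)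
    (hC0 : ∀ x y, 0 ≤ C x y) (hCs : ∀ x, Summable (C x))
    (hT : ∀ ⦃F : Ω → ℝ⦄ (x : ι), Adm F → Adm (T x F))
    (hdust : ∀ ⦃F : Ω → ℝ⦄ ⦃δ : ι → ℝ⦄ (x : ι), Adm F → Lip F δ →
      Lip (T x F) fun y => if y = x then 0 else δ y + C x y * δ x)
    (h₁le : ∀ ⦃F : Ω → ℝ⦄ ⦃M : ℝ⦄, Adm F → (∀ σ, F σ ≤ M) → E₁ F ≤ M)
    (h₁ge : ∀ ⦃F : Ω → ℝ⦄ ⦃M : ℝ⦄, Adm F → (∀ σ, M ≤ F σ) → M ≤ E₁ F)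
    (h₁T : ∀ ⦃F : Ω → ℝ⦄ (x : ι), Adm F → E₁ (T x F) = E₁ F)
    (h₂le : ∀ ⦃F : Ω → ℝ⦄ ⦃M : ℝ⦄, Adm F → (∀ σ, F σ ≤ M) → E₂ F ≤ M)
    (h₂ge : ∀ ⦃F : Ω → ℝ⦄ ⦃M : ℝ⦄, Adm F → (∀ σ, M ≤ F σ) → M ≤ E₂ F)
    (h₂D : ∀ ⦃F : Ω → ℝ⦄ ⦃δ : ι → ℝ⦄ (x : ι), Adm F → Lip F δ → |E₂ (T x F) - E₂ F| ≤ b x * δ x)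
    (hb0 : ∀ y, 0 ≤ b y)
    {phi : (ι → ℝ) → ι → ℝ} (hphi : ∀ a y, phi a y = ∑' z, C y z * a z + b y)
    {c : ℝ} (hc0 : 0 ≤ c) (hc1 : c ≤ 1) (hrow : ∀ y, ∑' z, C y z ≤ c)
    {d : ι → ℝ} (hd0 : ∀ y, 0 ≤ d y) (hdD : ∀ y, d y ≤ D)
    (hsuper : ∀ y, b y + ∑' z, C y z * d z ≤ d y)
    (n : ℕ) ⦃F : Ω → ℝ⦄ ⦃δ : ι → ℝ⦄ (hF : Adm F) (hδ : Lip F δ) :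
    |E₁ F - E₂ F| ≤ ∑' y, phi^[n] (fun _ => R) y * δ y := by
  classical
  induction n generalizing F δ with
  | zero => exact est_const_tsum hosc h₁le h₁ge h₂le h₂ge hF hδ
  | succ n ih =>
    rw [Function.iterate_succ_apply']
    have hmem := iterate_phiDefect_tsum_le hR hC0 hCs hb0 hphi hc0 hc1 hrow hd0 hdD hsuper n
    have hmem' := iterate_phiDefect_tsum_le hR hC0 hCs hb0 hphi hc0 hc1 hrow hd0 hdD hsuper (n + 1)
    have hB1 : ∀ y, phi^[n] (fun _ => R) y ≤ R + D := fun y =>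
      (hmem y).2.trans (add_le_add (mul_le_of_le_one_right hR (pow_le_one₀ hc0 hc1)) (hdD y))
    refine est_phiDefect_tsum (W := Set.univ) hlip0 hlips hC0 hCs hT hdust (fun F x _ hF => h₁T x hF)
      (fun F δ x _ hF hδ => h₂D x hF hδ) hb0 (phi := phi) (fun a y => by rw [hphi, if_pos (Set.mem_univ y)])
      ih (fun y => (hmem y).1) hB1 (fun y => ?_) hF hδ
    have h := (hmem' y).2
    rw [Function.iterate_succ_apply'] at h
    exact h.trans (add_le_add (mul_le_of_le_one_right hR (pow_le_one₀ hc0 hc1)) (hdD y))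

/-- **Föllmer's Comparison Theorem (2.8) with defects, summable rows, through a super-solution**
(Föllmer 1988, Ch. I, (2.8) with (2.10) and Remark (2.17); Georgii 2011, Thm. 8.20): for an invariant
monotone-normalised state `E₁`, a monotone-normalised state `E₂` whose defect at every site `x` is
`|E₂ (T x F) - E₂ F| ≤ b x · δ x`, summable rows `≤ c < 1`, and every bounded super-solution `d ≥ 0` of
`b + C d ≤ d`: every admissible `F` with (summable) Lipschitz vector `δ` satisfies
`|E₁ F - E₂ F| ≤ ∑' y, d y · δ y`. [cite: Follmer1988, Ch. I Comparison Theorem (2.8)] -/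
theorem abs_sub_le_tsum_of_superSolution {D : ℝ} (hR : 0 ≤ R)
    (hlip0 : ∀ ⦃F : Ω → ℝ⦄ ⦃δ : ι → ℝ⦄, Lip F δ → ∀ y, 0 ≤ δ y)
    (hlips : ∀ ⦃F : Ω → ℝ⦄ ⦃δ : ι → ℝ⦄, Lip F δ → Summable δ)
    (hosc : ∀ ⦃F : Ω → ℝ⦄ ⦃δ : ι → ℝ⦄, Adm F → Lip F δ → ∀ σ τ, |F σ - F τ| ≤ R * ∑' y, δ y)
    (hC0 : ∀ x y, 0 ≤ C x y) (hCs : ∀ x, Summable (C x))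
    (hT : ∀ ⦃F : Ω → ℝ⦄ (x : ι), Adm F → Adm (T x F))
    (hdust : ∀ ⦃F : Ω → ℝ⦄ ⦃δ : ι → ℝ⦄ (x : ι), Adm F → Lip F δ →
      Lip (T x F) fun y => if y = x then 0 else δ y + C x y * δ x)
    (h₁le : ∀ ⦃F : Ω → ℝ⦄ ⦃M : ℝ⦄, Adm F → (∀ σ, F σ ≤ M) → E₁ F ≤ M)
    (h₁ge : ∀ ⦃F : Ω → ℝ⦄ ⦃M : ℝ⦄, Adm F → (∀ σ, M ≤ F σ) → M ≤ E₁ F)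
    (h₁T : ∀ ⦃F : Ω → ℝ⦄ (x : ι), Adm F → E₁ (T x F) = E₁ F)
    (h₂le : ∀ ⦃F : Ω → ℝ⦄ ⦃M : ℝ⦄, Adm F → (∀ σ, F σ ≤ M) → E₂ F ≤ M)
    (h₂ge : ∀ ⦃F : Ω → ℝ⦄ ⦃M : ℝ⦄, Adm F → (∀ σ, M ≤ F σ) → M ≤ E₂ F)
    (h₂D : ∀ ⦃F : Ω → ℝ⦄ ⦃δ : ι → ℝ⦄ (x : ι), Adm F → Lip F δ → |E₂ (T x F) - E₂ F| ≤ b x * δ x)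
    (hb0 : ∀ y, 0 ≤ b y)
    {c : ℝ} (hc0 : 0 ≤ c) (hc1 : c < 1) (hrow : ∀ y, ∑' z, C y z ≤ c)
    {d : ι → ℝ} (hd0 : ∀ y, 0 ≤ d y) (hdD : ∀ y, d y ≤ D)
    (hsuper : ∀ y, b y + ∑' z, C y z * d z ≤ d y)
    ⦃F : Ω → ℝ⦄ ⦃δ : ι → ℝ⦄ (hF : Adm F) (hδ : Lip F δ) :
    |E₁ F - E₂ F| ≤ ∑' y, d y * δ y := by
  set phi : (ι → ℝ) → ι → ℝ := fun a y => ∑' z, C y z * a z + b y with hphidef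
  have hphi : ∀ a y, phi a y = ∑' z, C y z * a z + b y := fun _ _ => rfl
  have hδ0 := hlip0 hδ
  have hδs := hlips hδ
  have hsd : Summable fun y => d y * δ y := summable_mul_of_bdd' hd0 hdD hδ0 hδs
  have hB : ∀ n : ℕ, |E₁ F - E₂ F| ≤ R * c ^ n * ∑' y, δ y + ∑' y, d y * δ y := fun n => by
    have hmem := iterate_phiDefect_tsum_le hR hC0 hCs hb0 hphi hc0 hc1.le hrow hd0 hdD hsuper n
    refine (est_iterate_phiDefect_tsum hR hlip0 hlips hosc hC0 hCs hT hdust h₁le h₁ge h₁T h₂le h₂ge h₂D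
      hb0 hphi hc0 hc1.le hrow hd0 hdD hsuper n hF hδ).trans ?_
    have hB1 : ∀ y, phi^[n] (fun _ => R) y ≤ R + D := fun y =>
      (hmem y).2.trans (add_le_add (mul_le_of_le_one_right hR (pow_le_one₀ hc0 hc1.le)) (hdD y))
    have hs : Summable fun y => phi^[n] (fun _ => R) y * δ y :=
      summable_mul_of_bdd' (fun y => (hmem y).1) hB1 hδ0 hδs
    rw [← tsum_mul_left, ← (hδs.mul_left (R * c ^ n)).tsum_add hsd]
    refine hs.tsum_le_tsum (fun y => ?_) ((hδs.mul_left (R * c ^ n)).add hsd)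
    have h2 : phi^[n] (fun _ => R) y * δ y ≤ (R * c ^ n + d y) * δ y :=
      mul_le_mul_of_nonneg_right (hmem y).2 (hδ0 y)
    refine h2.trans (le_of_eq ?_)
    ring
  have hlim : Tendsto (fun n : ℕ => R * c ^ n * ∑' y, δ y + ∑' y, d y * δ y)
      atTop (𝓝 (R * 0 * ∑' y, δ y + ∑' y, d y * δ y)) :=
    ((((tendsto_pow_atTop_nhds_zero_of_lt_one hc0 hc1).const_mul R).mul_const _).add_const _)
  have h := ge_of_tendsto' hlim hB
  simpa using h

end Abstract

end DobrushinMetric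

end Literature.Probability.LatticeModels

end
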